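import Mathlib
import Literature.AlgebraicGeometry.Resolution.CechH1LerayRegularBirational
import Literature.AlgebraicGeometry.Resolution.Lipman1969RegularBaseH1Vanishing
import Literature.AlgebraicGeometry.Morphisms.CechH1LengthTransport
import HarnessLib

/-!
# `H¹(X, 𝒪_X) = 0` travels up and down a domination: Lipman 1969, proof of Proposition (1.2) 2),
# statement A) globally and the «canonical injection `H¹(W, h_*𝒪_Z) → H¹(Z, 𝒪_Z)`»

Topic: `Literature/AlgebraicGeometry/Resolution`.  PROVED, fact-free, definition-free plumbing towards the
named fact `Lipman1969_1_2` (J. Lipman, *Rational singularities, with applications to algebraic surfaces and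
unique factorization*, Publ. Math. IHÉS 36 (1969), Prop. (1.2) 2), p. 199; proof p. 200, read on the page of the
held copy `paper:doi-10-1007-bf02684604`, PDF p. 7):

> «Proof. — The proposition follows from two familiar facts: A) If `X` is any regular surface and `j : Z → X`
> is a quadratic transformation, then `H¹(Z, 𝒪_Z) ≅ H¹(X, 𝒪_X)`.  B) Let `f : X → Spec(R)` be a
> desingularization.  If `g` is proper, then there exists a commutative diagram of proper birational maps
> `Z → W`, `Z → X` … with `j` a product of quadratic transformations. … By induction A) holds also when `j` is
> a product of quadratic transformations; consequently if `X` and `Z` are as in B), and we assume, as we may,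
> that `H¹(X, 𝒪_X) = 0`, then also `H¹(Z, 𝒪_Z) = 0`.  If furthermore `W` is normal, then `h_*(𝒪_Z) = 𝒪_W`;
> since there is a canonical injection `H¹(W, h_*(𝒪_Z)) → H¹(Z, 𝒪_Z) = 0` we conclude that `H¹(W, 𝒪_W) = 0`,
> proving 2).»

In the tree's Čech vocabulary (`HasTrivialCechH1 f`: `Ȟ¹(𝒰, 𝒪) = 0` for every finite affine open cover):

* `hasTrivialCechH1_of_isIso_app` — **the canonical injection**: for `σ : Z → W` over `Spec R` with
  `σ_*𝒪_Z = 𝒪_W` (every `σ.app V` an isomorphism) and `Z` quasi-compact, `Ȟ¹(Z, 𝒪) = 0 ⇒ Ȟ¹(W, 𝒪) = 0`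
  (`Ȟ¹(𝒰, 𝒪_W) ↪ Ȟ¹(σ⁻¹𝒰, 𝒪_Z) ↪ Ȟ¹(𝒲, 𝒪_Z)` for a finite affine refinement `𝒲` of `σ⁻¹𝒰`:
  `cechComapH1_injective_of_comap`, `cechRefineH1_injective`);
* `hasTrivialCechH1_of_isBirational_of_isIntegrallyClosed` — the same for `σ` proper birational between
  integral schemes with `W` NORMAL (`σ_*𝒪_Z = 𝒪_W`, Stacks 0AY8, tree `isIso_app_of_surjective_of_isIso_morphismRestrict`);
* `hasTrivialCechH1_comp_of_isRegular` — **statement A) for any proper birational `ρ : Z → X` of REGULAR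
  schemes** (`X` integral Noetherian, proper over `Spec T`, local rings of dimension `≤ 2`): `Ȟ¹(X, 𝒪) = 0 ⇒
  Ȟ¹(Z, 𝒪) = 0` — the tree's pointwise Leray (L) `hasTrivialCechH1_comp_of_isBirational_of_forall_stalk` with its
  pointwise input discharged by `hasTrivialCechH1_of_isResolution_of_isRegularLocalRing` (every resolution of a
  two-dimensional regular local ring has `H¹ = 0`) on the base changes `Z ×_X Spec 𝒪_{X,x}`;
* `hasTrivialCechH1_of_isResolution_of_dominated` — **Prop. (1.2) 2) for a resolution `g : W → Spec R`
  MODULO statement B)**: if some resolution `π : X → Spec R` with `H¹(X, 𝒪_X) = 0` (the witness of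
  `HasRationalSingularity R`) and `W` are dominated by a common `Z` with `Z → X` a resolution, then
  `H¹(W, 𝒪_W) = 0`.  Statement B) (= Theorem (26.1), elimination of indeterminacies, p. 274) is NOT proved here
  and enters as an explicit hypothesis; the named fact `Lipman1969_1_2` stays PRINT.

No summit statement is proved.  AI-written; AI review is weaker than expert review.

## References
* J. Lipman, Publ. Math. IHÉS 36 (1969), Prop. (1.2) and its proof, pp. 199–200; Thm. (26.1), p. 274. [Lipman1969]
* The Stacks Project, Tag 0AY8 (More on Morphisms, Lemma 37.53.6), Tag 01ED, Tag 09UY. [StacksProject]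
* U. Görtz, T. Wedhorn, *Algebraic Geometry II* (2023), Cor. 21.81, Cor. 21.82. [GortzWedhorn2023]
-/

noncomputable section

open CategoryTheory CategoryTheory.Limits AlgebraicGeometry TopologicalSpace IsLocalRing
open Literature.AlgebraicGeometry.Morphisms

universe u

namespace Literature.AlgebraicGeometry.Resolution

/-! ## Finite affine refinements -/

/-- **Finite affine refinement of an open cover of a quasi-compact scheme** (indexed in the scheme's
universe): affine opens form a basis, and finitely many of those inside members of the cover still cover.
[folklore] -/
private theorem exists_finite_isAffineOpen_refinement_of_iSup_eq_top (X : Scheme.{u}) [CompactSpace X]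
    {α : Type*} (O : α → X.Opens) (hO : ⨆ a, O a = ⊤) :
    ∃ (ι : Type u) (_ : Finite ι) (U : ι → X.Opens) (r : ι → α),
      (∀ i, IsAffineOpen (U i)) ∧ (∀ i, U i ≤ O (r i)) ∧ ⨆ i, U i = ⊤ := by
  classical
  have hpt : ∀ x : X, ∃ p : X.Opens × α, IsAffineOpen p.1 ∧ x ∈ p.1 ∧ p.1 ≤ O p.2 := by
    intro x
    have hx : x ∈ ⨆ a, O a := by rw [hO]; trivial
    obtain ⟨a, ha⟩ := Opens.mem_iSup.mp hx
    obtain ⟨U, hU, hxU, hUO⟩ := Opens.isBasis_iff_nbhd.mp X.isBasis_affineOpens ha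
    exact ⟨(U, a), hU, hxU, hUO⟩
  choose p hp using hpt
  obtain ⟨t, ht⟩ := IsCompact.elim_finite_subcover CompactSpace.isCompact_univ
    (fun x : X => ((p x).1 : Set X)) (fun x => (p x).1.2)
    (fun x _ => Set.mem_iUnion.mpr ⟨x, (hp x).2.1⟩)
  refine ⟨↥t, inferInstance, fun i => (p i.1).1, fun i => (p i.1).2, fun i => (hp i.1).1,
    fun i => (hp i.1).2.2, ?_⟩
  refine top_le_iff.mp fun x _ => ?_
  have hx := ht (Set.mem_univ x)
  simp only [Set.mem_iUnion] at hx
  obtain ⟨y, hy, hxy⟩ := hx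
  exact Opens.mem_iSup.mpr ⟨⟨y, hy⟩, hxy⟩

/-! ## The canonical injection `H¹(W, σ_*𝒪_Z) ↪ H¹(Z, 𝒪_Z)`: descent of `Ȟ¹ = 0` along `σ_*𝒪_Z = 𝒪_W` -/

section Descent

variable {R : Type u} [CommRing R] {Z W : Scheme.{u}} (σ : Z ⟶ W) (g : W ⟶ Spec (.of R))

/-- With `σ.app V` an isomorphism, the section pullback `𝒪_W(V) → 𝒪_Z(V')`, `V' = σ⁻¹V`, is bijective.
[folklore] -/
private theorem comap_bijective_of_isIso_app'' {V : W.Opens} {V' : Z.Opens} (e : V' ≤ σ ⁻¹ᵁ V)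
    (heq : V' = σ ⁻¹ᵁ V) [IsIso (σ.app V)] :
    Function.Bijective (Sections.comap g (σ ≫ g) σ rfl e) := by
  subst heq
  rw [show (Sections.comap g (σ ≫ g) σ rfl e : _ → _) = (σ.app V).hom from by
    funext s; rw [Sections.comap_apply, Scheme.Hom.appLE_eq_app]]
  exact ConcreteCategory.bijective_of_isIso (σ.app V)

/-- **Lipman's «canonical injection `H¹(W, h_*𝒪_Z) → H¹(Z, 𝒪_Z)`», Čech form: `Ȟ¹ = 0` descends along a
morphism with `σ_*𝒪_Z = 𝒪_W`.**  For `σ : Z → W` over `Spec R` with `Z` quasi-compact and every sheaf map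
`𝒪_W(V) → 𝒪_Z(σ⁻¹V)` an isomorphism, if `Ȟ¹(𝒲, 𝒪_Z) = 0` for every finite affine open cover `𝒲` of `Z`, then
`Ȟ¹(𝒰, 𝒪_W) = 0` for every finite affine open cover `𝒰` of `W`: the composite
`Ȟ¹(𝒰, 𝒪_W) → Ȟ¹(σ⁻¹𝒰, 𝒪_Z) → Ȟ¹(𝒲, 𝒪_Z)`, `𝒲` a finite affine refinement of `σ⁻¹𝒰`, is injective
(a cocycle on `𝒰` pulling back to a coboundary `d⁰b'` is the coboundary of the descent of `b'`; refinement is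
injective on `Ȟ¹`). [cite: Lipman1969, Proposition (1.2), proof of 2) (p. 200)]
[cite: GortzWedhorn2023, Cor. 21.81 (p. 265)] -/
theorem hasTrivialCechH1_of_isIso_app [CompactSpace Z] (happ : ∀ V : W.Opens, IsIso (σ.app V))
    (hZ : HasTrivialCechH1 (σ ≫ g)) : HasTrivialCechH1 g := by
  classical
  intro ι _ U hU hcov
  -- a finite affine refinement `𝒲` of `σ⁻¹𝒰`
  obtain ⟨κ, _, WZ, r, hWZaff, hWZr, hWZcov⟩ := exists_finite_isAffineOpen_refinement_of_iSup_eq_top Z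
    (fun i => σ ⁻¹ᵁ U i) (by rw [← Scheme.Hom.preimage_iSup, hcov]; exact Opens.map_top _)
  haveI : Subsingleton (CechH1 (σ ≫ g) WZ) := hZ κ WZ hWZaff hWZcov
  -- `Ȟ¹(𝒰, 𝒪_W) ↪ Ȟ¹(σ⁻¹𝒰, 𝒪_Z)`
  have h1 : Function.Injective (cechComapH1 g (σ ≫ g) σ rfl U) :=
    cechComapH1_injective_of_comap g (σ ≫ g) σ rfl U
      (fun i => (comap_bijective_of_isIso_app'' σ g _ rfl).2)
      (fun i j => (comap_bijective_of_isIso_app'' σ g _ rfl).1)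
  -- `Ȟ¹(σ⁻¹𝒰, 𝒪_Z) ↪ Ȟ¹(𝒲, 𝒪_Z)`
  have h2 : Function.Injective (cechRefineH1 (σ ≫ g) (preimageFamily σ U) WZ r hWZr) :=
    cechRefineH1_injective (σ ≫ g) (preimageFamily σ U) WZ r hWZr (fun i => by rw [hWZcov]; exact le_top)
  refine ⟨fun a b => h1 (h2 (Subsingleton.elim _ _))⟩

/-- **`Ȟ¹ = 0` descends along a proper birational morphism onto a NORMAL integral scheme** (then
`σ_*𝒪_Z = 𝒪_W`, Stacks 0AY8): for `σ : Z → W` proper birational between integral schemes over `Spec R`, all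
local rings of `W` integrally closed, `Ȟ¹(Z, 𝒪) = 0 ⇒ Ȟ¹(W, 𝒪) = 0` (in the sense of `HasTrivialCechH1`).
This is the last step of Lipman's proof of Prop. (1.2) 2). [cite: Lipman1969, Proposition (1.2), proof of 2) (p. 200)]
[cite: StacksProject, Tag 0AY8 (More on Morphisms, Lemma 37.53.6)] -/
theorem hasTrivialCechH1_of_isBirational_of_isIntegrallyClosed [IsIntegral Z] [IsIntegral W]
    [CompactSpace Z] [IsProper σ] (hσ : IsBirational σ)
    (hWn : ∀ w : W, IsIntegrallyClosed (W.presheaf.stalk w)) (hZ : HasTrivialCechH1 (σ ≫ g)) :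
    HasTrivialCechH1 g := by
  haveI : IsDominant σ := hσ.isDominant
  obtain ⟨O, hO, -, hiso⟩ := hσ
  haveI := hiso
  exact hasTrivialCechH1_of_isIso_app σ g
    (fun V => isIso_app_of_surjective_of_isIso_morphismRestrict σ hWn O hO.nonempty V) hZ

end Descent

/-! ## Statement A) globally: `Ȟ¹ = 0` ascends along a proper birational morphism of regular surfaces -/

section Ascent

/-- **Lipman (1.2), statement A) for an arbitrary proper birational morphism of regular surfaces** («By
induction A) holds also when `j` is a product of quadratic transformations»; here without any factorisation):
for `ρ : Z → X` proper birational with `Z` and `X` regular, `X` integral Noetherian and proper over `Spec T`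
with local rings of dimension `≤ 2`, `Ȟ¹(X, 𝒪) = 0 ⇒ Ȟ¹(Z, 𝒪) = 0` on every finite affine open cover.  Proof:
the tree's pointwise Leray `hasTrivialCechH1_comp_of_isBirational_of_forall_stalk`, whose input at a point `x`
with `dim 𝒪_{X,x} = 2` — `Ȟ¹ = 0` on `Z ×_X Spec 𝒪_{X,x}`, a resolution of the REGULAR two-dimensional local
ring `𝒪_{X,x}` (`IsResolution.pullback_snd_fromSpecStalk`) — is the tree theorem
`hasTrivialCechH1_of_isResolution_of_isRegularLocalRing` (Lipman (1.2) 2) over a regular base).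
[cite: Lipman1969, Proposition (1.2), proof, statement A) (p. 200)] [cite: EGAIII1, Prop. (1.4.15)] -/
theorem hasTrivialCechH1_comp_of_isRegular {T : Type u} [CommRing T] {Z X : Scheme.{u}} [IsIntegral X]
    [IsNoetherian X] [IsNoetherian Z] (πX : X ⟶ Spec (.of T)) [IsProper πX] (ρ : Z ⟶ X) [IsProper ρ]
    (hρ : IsBirational ρ) (hZ : Scheme.IsRegular Z) (hX : Scheme.IsRegular X)
    (hdimX : ∀ x : X, ringKrullDim (X.presheaf.stalk x) ≤ 2) (h0 : HasTrivialCechH1 πX) :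
    HasTrivialCechH1 (ρ ≫ πX) := by
  have hres : IsResolution ρ := ⟨inferInstance, hρ, hZ⟩
  refine hasTrivialCechH1_comp_of_isBirational_of_forall_stalk πX ρ hρ hZ hX hdimX (fun x hx => ?_) h0
  haveI : IsRegularLocalRing (X.presheaf.stalk x) := hX x
  exact hasTrivialCechH1_of_isResolution_of_isRegularLocalRing hx _ (hres.pullback_snd_fromSpecStalk x)

end Ascent

/-! ## Dimension of the local rings of a resolution of a two-dimensional local domain -/

section Dimension

/-- The local rings of a scheme birational and locally of finite type over `Spec R`, `R` a Noetherian domain of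
Krull dimension `≤ 2` (integral source, Noetherian), have dimension `≤ 2`: `dim 𝒪_{X,x} ≤ dim 𝒪_{Spec R, π x}`
(the dimension inequality, tree `ringKrullDim_stalk_le_of_forall_genericPoints`, the stalk map at the generic
point being surjective for a birational `π`) and `dim R_𝔭 ≤ dim R`. [cite: Matsumura1987, Thm. 15.5]
[cite: EGAIV2, 5.6.5.1] -/
theorem ringKrullDim_stalk_le_two_of_isBirational {R : Type u} [CommRing R] [IsNoetherianRing R]
    (hdim : ringKrullDim R ≤ 2) {X : Scheme.{u}} [IsIntegral X] [IsNoetherian X]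
    (π : X ⟶ Spec (.of R)) [LocallyOfFiniteType π] (hπ : IsBirational π) (x : X) :
    ringKrullDim (X.presheaf.stalk x) ≤ 2 := by
  have h1 := ringKrullDim_stalk_le_of_forall_genericPoints π x
    (fun η hη _ => hπ.surjective_stalkMap_of_mem_genericPoints hη)
  refine h1.trans ?_
  -- `𝒪_{Spec R, p} = R_p` has dimension `height p ≤ dim R`
  letI : Algebra R ((Spec (.of R)).presheaf.stalk (π.base x)) := StructureSheaf.stalkAlgebra R (π.base x)
  haveI : IsLocalization.AtPrime ((Spec (.of R)).presheaf.stalk (π.base x)) (π.base x).asIdeal :=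
    StructureSheaf.IsLocalization.to_stalk R (π.base x)
  have h2 : ringKrullDim ((Spec (.of R)).presheaf.stalk (π.base x)) ≤ ringKrullDim R := by
    rw [IsLocalization.AtPrime.ringKrullDim_eq_height (π.base x).asIdeal
      ((Spec (.of R)).presheaf.stalk (π.base x))]
    exact Ideal.height_le_ringKrullDim_of_ne_top Ideal.IsPrime.ne_top'
  exact h2.trans hdim

end Dimension

/-! ## Birationality of a factor -/

/-- Birationality of a factor: if `q : M → S` and `s ≫ q : Y → S` are birational, with `Y` and `M`
irreducible, then so is `s` — over `q⁻¹(U₁ ∩ U₂)`, where `U₁`, `U₂ ⊆ S` are the dense opens over which `s ≫ q`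
and `q` are isomorphisms, `s` restricts to (isomorphism) ≫ (isomorphism)⁻¹ (the tree's private
`isBirational_of_comp'` of `ResolutionFactorsThroughBlowup`). [folklore] -/
private theorem isBirational_of_comp_of_isBirational {Y M S : Scheme.{u}} [IrreducibleSpace Y] [IrreducibleSpace M]
    {s : Y ⟶ M} {q : M ⟶ S} (hq : IsBirational q) (h : IsBirational (s ≫ q)) :
    IsBirational s := by
  obtain ⟨U₁, hU₁, -, hiso₁⟩ := h
  obtain ⟨U₂, hU₂, -, hiso₂⟩ := hq
  haveI : Nonempty S := ⟨q (Classical.arbitrary M)⟩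
  have hne : ((U₁ ⊓ U₂ : S.Opens) : Set S).Nonempty := by
    rw [Opens.coe_inf, Set.inter_comm]
    exact hU₁.inter_open_nonempty U₂ U₂.2 hU₂.nonempty
  haveI h₁ : IsIso ((s ≫ q) ∣_ (U₁ ⊓ U₂)) := isIso_morphismRestrict_of_le _ hiso₁ inf_le_left
  haveI h₂ : IsIso (q ∣_ (U₁ ⊓ U₂)) := isIso_morphismRestrict_of_le _ hiso₂ inf_le_right
  obtain ⟨x, hx⟩ := hne
  let y : ↥((s ≫ q) ⁻¹ᵁ (U₁ ⊓ U₂)) :=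
    (Scheme.homeoOfIso (asIso ((s ≫ q) ∣_ (U₁ ⊓ U₂)))).symm ⟨x, hx⟩
  have hy : (y : Y) ∈ (s ≫ q) ⁻¹ᵁ (U₁ ⊓ U₂) := y.2
  refine ⟨q ⁻¹ᵁ (U₁ ⊓ U₂), ?_, ?_, ?_⟩
  · exact (q ⁻¹ᵁ (U₁ ⊓ U₂)).2.dense
      ⟨s y, show q (s y) ∈ U₁ ⊓ U₂ by rw [← Scheme.Hom.comp_apply]; exact hy⟩
  · rw [← Scheme.Hom.comp_preimage]
    exact ((s ≫ q) ⁻¹ᵁ (U₁ ⊓ U₂)).2.dense ⟨y, hy⟩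
  · haveI : IsIso (s ∣_ q ⁻¹ᵁ (U₁ ⊓ U₂) ≫ q ∣_ (U₁ ⊓ U₂)) := by
      rw [← morphismRestrict_comp]
      exact h₁
    exact IsIso.of_isIso_comp_right (s ∣_ q ⁻¹ᵁ (U₁ ⊓ U₂)) (q ∣_ (U₁ ⊓ U₂))

/-! ## Proposition (1.2) 2) for resolutions, modulo statement B) -/

section Assembly

/-- **Lipman 1969, Proposition (1.2) 2) for a resolution `g : W → Spec R`, MODULO statement B) of its proof**
(= Theorem (26.1), elimination of indeterminacies by quadratic transformations).  Let `R` be a commutative ring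
(in Lipman: a two-dimensional normal local domain) with a rational singularity in the sense of Def. (1.1):
some resolution `π : X → Spec R` has `H¹(X, 𝒪_X) = 0`.  Let `g : W → Spec R` be a resolution, and assume B):
every resolution `π : X → Spec R` and `W` are dominated by a common `Z` — morphisms `j : Z → X`, `h : Z → W`
with `j` a resolution (proper birational, `Z` regular; in print `j` is a product of quadratic transformations)
and `h ≫ g = j ≫ π`.  If moreover `R` is a Noetherian domain of Krull dimension `≤ 2`, then `H¹(W, 𝒪_W) = 0`
(`HasTrivialCechH1 g`).  Proof = Lipman's, p. 200: `H¹(Z, 𝒪_Z) = 0` by A) globally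
(`hasTrivialCechH1_comp_of_isRegular`), `h` is proper (cancellation) and birational, `W` is regular hence
normal, so `h_*𝒪_Z = 𝒪_W` and `H¹(W, 𝒪_W) ↪ H¹(Z, 𝒪_Z) = 0` (`hasTrivialCechH1_of_isBirational_of_isIntegrallyClosed`).
The named fact `Lipman1969_1_2` itself stays PRINT; this discharges it down to B).
[cite: Lipman1969, Proposition (1.2) 2) (p. 199) and its proof, statements A), B) (p. 200); Theorem (26.1) (p. 274)] -/
theorem hasTrivialCechH1_of_isResolution_of_dominated {R : Type u} [CommRing R] [IsNoetherianRing R]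
    [IsDomain R] (hdim : ringKrullDim R ≤ 2) (hrat : HasRationalSingularity R) {W : Scheme.{u}}
    (g : W ⟶ Spec (.of R)) (hg : IsResolution g)
    (hB : ∀ (X : Scheme.{u}) (π : X ⟶ Spec (.of R)), IsResolution π → HasTrivialCechH1 π →
      ∃ (Z : Scheme.{u}) (j : Z ⟶ X) (h : Z ⟶ W), IsResolution j ∧ h ≫ g = j ≫ π) :
    HasTrivialCechH1 g := by
  obtain ⟨X, π, hπ, hH⟩ := hrat
  obtain ⟨Z, j, h, hj, hfac⟩ := hB X π hπ hH
  haveI : IsProper π := hπ.isProper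
  haveI : IsProper g := hg.isProper
  haveI : IsProper j := hj.isProper
  haveI : IsIntegral X := hπ.isIntegral_source
  haveI : IsIntegral W := hg.isIntegral_source
  haveI : IsIntegral Z := hj.isIntegral_source
  haveI : IsNoetherian X := by
    haveI : IsLocallyNoetherian X := LocallyOfFiniteType.isLocallyNoetherian π
    haveI : CompactSpace X := QuasiCompact.compactSpace_of_compactSpace π
    exact {}
  haveI : IsNoetherian Z := by
    haveI : IsLocallyNoetherian Z := LocallyOfFiniteType.isLocallyNoetherian (j ≫ π)
    haveI : CompactSpace Z := QuasiCompact.compactSpace_of_compactSpace (j ≫ π)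
    exact {}
  -- `H¹(Z, 𝒪_Z) = 0` by A)
  have hZ : HasTrivialCechH1 (j ≫ π) :=
    hasTrivialCechH1_comp_of_isRegular π j hj.isBirational hj.isRegular hπ.isRegular
      (ringKrullDim_stalk_le_two_of_isBirational hdim π hπ.isBirational) hH
  rw [← hfac] at hZ
  -- `h` is proper (cancellation against the separated `g`) and birational
  haveI : IsProper (h ≫ g) := by rw [hfac]; infer_instance
  haveI : IsProper h := IsProper.of_comp h g
  have hh : IsBirational h :=
    isBirational_of_comp_of_isBirational hg.isBirational (by rw [hfac]; exact hj.isBirational.comp hπ.isBirational)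
  -- `W` is regular, hence normal: descend
  exact hasTrivialCechH1_of_isBirational_of_isIntegrallyClosed h g hh
    (fun w => by haveI := hg.isRegular w; exact isIntegrallyClosed_of_isRegularLocalRing _) hZ

end Assembly

/-! ## Proposition (1.2) 1): the residue is the local vanishing `R¹h_*𝒪_Z = 0` at the point -/

section PartOne

/-- **Lipman 1969, Proposition (1.2) 1), packaging of its last step** («let `h : Z → W` be as in B) with
`H¹(Z, 𝒪_Z) = 0` as before, and let `V = Spec(𝒪_w) ×_W Z`.  `V` is proper and birational over `Spec(𝒪_w)`, `V` is
regular, and … `H¹(V, 𝒪_V) = 0`», p. 200): for a resolution `h : Z → W` (`W` integral Noetherian, `Z` Noetherian)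
and a point `w`, the base change `Z ×_W Spec 𝒪_{W,w} → Spec 𝒪_{W,w}` is a resolution
(`IsResolution.pullback_snd_fromSpecStalk`), so the LOCAL vanishing `Ȟ¹ = 0` on it — Lipman's «`R¹h_*(𝒪_Z) = 0`»,
footnote (1) p. 200, the part NOT proved in this file — is exactly what makes `𝒪_{W,w}` a rational singularity in the
sense of Definition (1.1). [cite: Lipman1969, Proposition (1.2) 1), proof (p. 200) with footnote (1)] -/
theorem hasRationalSingularity_stalk_of_hasTrivialCechH1_pullback {Z W : Scheme.{u}} [IsIntegral W]
    [IsNoetherian W] [IsNoetherian Z] {h : Z ⟶ W} (hh : IsResolution h) (w : W)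
    (hV : HasTrivialCechH1 (pullback.snd h (W.fromSpecStalk w))) :
    HasRationalSingularity (W.presheaf.stalk w) :=
  ⟨_, pullback.snd h (W.fromSpecStalk w), hh.pullback_snd_fromSpecStalk w, hV⟩

/-- The same at a REGULAR point of dimension `≤ 2` needs no hypothesis: there the local vanishing is the tree's
(L1) `IsResolution.hasTrivialCechH1_pullback_snd_fromSpecStalk` with its dimension-two input supplied by
`hasTrivialCechH1_of_isResolution_of_isRegularLocalRing` (and, of course, a regular local ring is a rational
singularity outright — Lipman's remark after Definition (1.1)). [cite: Lipman1969, Definition (1.1) (p. 199)] -/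
theorem hasTrivialCechH1_pullback_snd_fromSpecStalk_of_isRegularLocalRing {Z W : Scheme.{u}} [IsIntegral W]
    [IsNoetherian W] [IsNoetherian Z] {h : Z ⟶ W} (hh : IsResolution h) (w : W)
    (hw : IsRegularLocalRing (W.presheaf.stalk w)) (hdim : ringKrullDim (W.presheaf.stalk w) ≤ 2) :
    HasTrivialCechH1 (pullback.snd h (W.fromSpecStalk w)) := by
  refine hh.hasTrivialCechH1_pullback_snd_fromSpecStalk w hw hdim fun h2 => ?_
  haveI := hw
  exact hasTrivialCechH1_of_isResolution_of_isRegularLocalRing h2 _ (hh.pullback_snd_fromSpecStalk w)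

end PartOne

end Literature.AlgebraicGeometry.Resolution

end
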